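import Literature.NumberTheory.Transcendental.KZLogCalculusProofs
import Literature.NumberTheory.Transcendental.KZRayDilog

/-!
# `OffTetraSectorKernel`, line `odd-hyperbolic-ladder`: the square-rooted ray representation exists
(stub `stub_rayCarriersExist`, conjunct (3))

Helper file of the registered existence stub `stub_rayCarriersExist` of the crux
`OffTetraSectorKernel` (stmt-KontsevichZagierPeriods-10557, route HyperbolicBloch, skeleton v11
"the Bloch–Wigner oracle is divisible"). For real algebraic `a`, `b > 0`, `r > 0` (`z = a + ib`,
`q(s) = (1 − s a)² + (s b)²`) the SQUARE-ROOTED RAY REPRESENTATION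
`Ray₁(a, b, r) = [{0 < s < 1, u strictly between 1 and s r}, sgn(u − 1)(−b)/(u q(s))]`
IS a Kontsevich–Zagier integral representation (`KZ.IntegralRep 2`: `ℚ`-semialgebraic domain,
`ℚ`-semialgebraic integrand, absolutely convergent integral). It is literally Zagier's ray
representation `KZ.rayDilogRep` of `KZRayDilog.lean` with the fibre top `V(s) = s²(a² + b²)`
replaced by `s·r` and `2u` by `u` (the fibrewise substitution `u = v²`), and the proofs are the
same: `|integrand| ≤ (a² + b²)/|b| · max(r^{1/2}, r^{-1/2}) · s^{-1/2} u^{-1/2}`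
(`rayCarriers_ray_abs_le`, from `|1 − s z|² ≥ b²/(a² + b²)`, `KZ.rayDilog_sq_le_mul_den`), a
product of one-variable integrable powers.

References: M. Kontsevich, D. Zagier, *Periods* (2001), §1.1; D. Zagier, *The dilogarithm
function* (2007), Ch. I §3. No definitions are introduced.
-/

noncomputable section

open Set MeasureTheory MvPolynomial
open Literature.NumberTheory.Transcendental Literature.ModelTheory.ExponentialFields

namespace Summit.KontsevichZagierPeriods.HyperbolicBloch.OffTetraSectorKernel

/-! ### Common estimates -/

/-- `|b| / ((1 − s a)² + (s b)²) ≤ (a² + b²)/|b|` for `b ≠ 0`: `|1 − s z|² ≥ (Im z)²/|z|²`.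
[cite: KontsevichZagier2001, §1.1] -/
theorem rayCarriers_abs_div_den_le (a : ℝ) {b : ℝ} (hb : b ≠ 0) (s : ℝ) :
    |b| / ((1 - s * a) ^ 2 + (s * b) ^ 2) ≤ (a ^ 2 + b ^ 2) / |b| := by
  have hd : 0 < (1 - s * a) ^ 2 + (s * b) ^ 2 := KZ.rayDilog_den_pos hb a s
  have hb' : 0 < |b| := abs_pos.mpr hb
  rw [div_le_div_iff₀ hd hb']
  calc |b| * |b| = b ^ 2 := (abs_mul_abs_self b).trans (sq b).symm
    _ ≤ _ := KZ.rayDilog_sq_le_mul_den a b s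

/-! ### The square-rooted ray representation `Ray₁(a, b, r)` -/

/-- Points of the ray domain have first coordinate in `(0, 1)` and positive second coordinate
(`u > min(1, s r) > 0`). [cite: KontsevichZagier2001, §1.1] -/
theorem rayCarriers_ray_pos {r : ℝ} (hr : 0 < r) {w : Fin 2 → ℝ}
    (hw : w ∈ {w : Fin 2 → ℝ | (0 < w 0 ∧ w 0 < 1) ∧
      ((1 < w 1 ∧ w 1 < w 0 * r) ∨ (w 0 * r < w 1 ∧ w 1 < 1))}) :
    (0 < w 0 ∧ w 0 < 1) ∧ 0 < w 1 := by
  refine ⟨hw.1, ?_⟩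
  rcases hw.2 with h | h
  · exact zero_lt_one.trans h.1
  · exact (mul_pos hw.1.1 hr).trans h.1

/-- The ray domain `{0 < s < 1, u strictly between 1 and s r}` is `ℚ`-semialgebraic for real
algebraic `r` (a Boolean combination of sign conditions on `ℚ̄`-polynomials; adapted from
`KZ.isSemialgebraic_rayDilogDomain`). [cite: KontsevichZagier2001, §1.1] -/
theorem rayCarriers_ray_isSemialgebraic {r : ℝ} (hr : IsAlgebraic ℚ r) :
    IsSemialgebraic ℚ {w : Fin 2 → ℝ | (0 < w 0 ∧ w 0 < 1) ∧
      ((1 < w 1 ∧ w 1 < w 0 * r) ∨ (w 0 * r < w 1 ∧ w 1 < 1))} := by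
  have hu : IsSemialgebraic ℚ (univ : Set (Fin 2 → ℝ)) := isSemialgebraic_univ
  have h0 : IsSemialgebraicFunOn ℚ (univ : Set (Fin 2 → ℝ)) (fun w => w 0) := by
    simpa using isSemialgebraicFunOn_aeval hu (X 0 : MvPolynomial (Fin 2) ℚ)
  have h1 : IsSemialgebraicFunOn ℚ (univ : Set (Fin 2 → ℝ)) (fun w => w 1) := by
    simpa using isSemialgebraicFunOn_aeval hu (X 1 : MvPolynomial (Fin 2) ℚ)
  have hV : IsSemialgebraicFunOn ℚ (univ : Set (Fin 2 → ℝ)) (fun w => w 0 * r) :=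
    (IsSemialgebraicFunOn.mul_holds h0 (isSemialgebraicFunOn_const_of_isAlgebraic hu hr)).congr
      fun w _ => by simp only [Pi.mul_apply]
  have hB : IsSemialgebraic ℚ {w : Fin 2 → ℝ | w 1 < w 0 * r} := by
    convert (IsSemialgebraicFunOn.sub_holds h1 hV).isSemialgebraic_sep_neg using 1
    ext w
    simp [sub_neg]
  have hC : IsSemialgebraic ℚ {w : Fin 2 → ℝ | w 0 * r < w 1} := by
    convert (IsSemialgebraicFunOn.sub_holds hV h1).isSemialgebraic_sep_neg using 1
    ext w
    simp [sub_neg]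
  have hA0 : IsSemialgebraic ℚ {w : Fin 2 → ℝ | 0 < w 0} := by
    simpa using isSemialgebraic_setOf_eval_pos (k := ℚ) (R := ℝ) (X 0 : MvPolynomial (Fin 2) ℚ)
  have hA1 : IsSemialgebraic ℚ {w : Fin 2 → ℝ | w 0 < 1} := by
    simpa using isSemialgebraic_setOf_eval_lt (k := ℚ) (R := ℝ) (X 0 : MvPolynomial (Fin 2) ℚ) 1
  have hP1 : IsSemialgebraic ℚ {w : Fin 2 → ℝ | 1 < w 1} := by
    simpa using isSemialgebraic_setOf_eval_lt (k := ℚ) (R := ℝ) 1 (X 1 : MvPolynomial (Fin 2) ℚ)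
  have hP2 : IsSemialgebraic ℚ {w : Fin 2 → ℝ | w 1 < 1} := by
    simpa using isSemialgebraic_setOf_eval_lt (k := ℚ) (R := ℝ) (X 1 : MvPolynomial (Fin 2) ℚ) 1
  convert (hA0.inter hA1).inter ((hP1.inter hB).union (hC.inter hP2)) using 1
  ext w
  simp only [mem_setOf_eq, mem_inter_iff, mem_union]

/-- The ray integrand `sgn(u − 1) · (−b) / (u ((1 − s a)² + (s b)²))` is `ℚ`-semialgebraic on the
ray domain for real algebraic `a`, `b ≠ 0`, `r > 0` (sign factor glued from two constants,
`KZ.isSemialgebraicFunOn_rayDilogSign`; a quotient of `ℚ̄`-polynomials with non-vanishing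
denominator; adapted from `KZ.isSemialgebraicFunOn_rayDilogIntegrand`).
[cite: KontsevichZagier2001, §1.1] -/
theorem rayCarriers_ray_isSemialgebraicFunOn {a b r : ℝ} (ha : IsAlgebraic ℚ a)
    (hb : IsAlgebraic ℚ b) (hr : IsAlgebraic ℚ r) (hb0 : b ≠ 0) (hr0 : 0 < r) :
    IsSemialgebraicFunOn ℚ {w : Fin 2 → ℝ | (0 < w 0 ∧ w 0 < 1) ∧
      ((1 < w 1 ∧ w 1 < w 0 * r) ∨ (w 0 * r < w 1 ∧ w 1 < 1))}
      (fun w => (if 1 < w 1 then (1 : ℝ) else -1) * (-b) /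
        (w 1 * ((1 - w 0 * a) ^ 2 + (w 0 * b) ^ 2))) := by
  have hD := rayCarriers_ray_isSemialgebraic hr
  have hu : IsSemialgebraic ℚ (univ : Set (Fin 2 → ℝ)) := isSemialgebraic_univ
  have h0 : IsSemialgebraicFunOn ℚ (univ : Set (Fin 2 → ℝ)) (fun w => w 0) := by
    simpa using isSemialgebraicFunOn_aeval hu (X 0 : MvPolynomial (Fin 2) ℚ)
  have h1 : IsSemialgebraicFunOn ℚ (univ : Set (Fin 2 → ℝ)) (fun w => w 1) := by
    simpa using isSemialgebraicFunOn_aeval hu (X 1 : MvPolynomial (Fin 2) ℚ)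
  have haC := isSemialgebraicFunOn_const_of_isAlgebraic hu ha
  have hbC := isSemialgebraicFunOn_const_of_isAlgebraic hu hb
  have hden : IsSemialgebraicFunOn ℚ (univ : Set (Fin 2 → ℝ))
      (fun w => w 1 * ((1 - w 0 * a) ^ 2 + (w 0 * b) ^ 2)) := by
    have e1 := IsSemialgebraicFunOn.sub_holds (isSemialgebraicFunOn_natCast hu 1)
      (IsSemialgebraicFunOn.mul_holds h0 haC)
    have e2 := IsSemialgebraicFunOn.mul_holds h0 hbC
    have h := IsSemialgebraicFunOn.mul_holds h1
      (IsSemialgebraicFunOn.add_holds (IsSemialgebraicFunOn.mul_holds e1 e1)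
        (IsSemialgebraicFunOn.mul_holds e2 e2))
    refine h.congr fun w _ => ?_
    simp only [Pi.mul_apply, Pi.add_apply, Pi.sub_apply, Nat.cast_one]
    ring
  have hden0 : ∀ w ∈ {w : Fin 2 → ℝ | (0 < w 0 ∧ w 0 < 1) ∧
      ((1 < w 1 ∧ w 1 < w 0 * r) ∨ (w 0 * r < w 1 ∧ w 1 < 1))},
      w 1 * ((1 - w 0 * a) ^ 2 + (w 0 * b) ^ 2) ≠ 0 :=
    fun w hw => (mul_pos (rayCarriers_ray_pos hr0 hw).2 (KZ.rayDilog_den_pos hb0 a (w 0))).ne'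
  have h := IsSemialgebraicFunOn.mul_holds
    (KZ.isSemialgebraicFunOn_rayDilogSign.mono (subset_univ _) hD)
    ((hbC.neg.mono (subset_univ _) hD).div (hden.mono (subset_univ _) hD) hden0)
  refine h.congr fun w _ => ?_
  simp only [Pi.mul_apply, Pi.neg_apply]
  ring

/-- **Pointwise domination** on the ray domain (`b ≠ 0`, `r > 0`): with `c = a² + b²`,
`|f(s, u)| ≤ (c/|b|) · max(r^{1/2}, r^{-1/2}) · s^{-1/2} · u^{-1/2}`: indeed
`|f| = |b|/(u |1 − sz|²) ≤ c/(|b| u)`, and `1/u ≤ 1 ≤ r^{1/2} s^{-1/2} u^{-1/2}` on the sheet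
`1 < u < s r ≤ r`, `1/u = u^{-1/2} u^{-1/2} ≤ (s r)^{-1/2} u^{-1/2}` on the sheet `s r < u < 1`
(adapted from `KZ.abs_rayDilogIntegrand_le`). [cite: Zagier2007Dilogarithm, Ch. I §3] -/
theorem rayCarriers_ray_abs_le (a : ℝ) {b r : ℝ} (hb0 : b ≠ 0) (hr0 : 0 < r) {w : Fin 2 → ℝ}
    (hw : w ∈ {w : Fin 2 → ℝ | (0 < w 0 ∧ w 0 < 1) ∧
      ((1 < w 1 ∧ w 1 < w 0 * r) ∨ (w 0 * r < w 1 ∧ w 1 < 1))}) :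
    |(if 1 < w 1 then (1 : ℝ) else -1) * (-b) / (w 1 * ((1 - w 0 * a) ^ 2 + (w 0 * b) ^ 2))| ≤
      (a ^ 2 + b ^ 2) / |b| * max (r ^ (1 / 2 : ℝ)) (r ^ (-(1 / 2) : ℝ)) *
        (w 0 ^ (-(1 / 2) : ℝ) * w 1 ^ (-(1 / 2) : ℝ)) := by
  have hs : 0 < w 0 ∧ w 0 < 1 := (rayCarriers_ray_pos hr0 hw).1
  have hu : 0 < w 1 := (rayCarriers_ray_pos hr0 hw).2
  have hd : 0 < (1 - w 0 * a) ^ 2 + (w 0 * b) ^ 2 := KZ.rayDilog_den_pos hb0 a (w 0)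
  -- step 1: `|f| = (|b| / d) · u⁻¹ ≤ c/|b| · u⁻¹`
  have h1 : |(if 1 < w 1 then (1 : ℝ) else -1) * (-b) /
      (w 1 * ((1 - w 0 * a) ^ 2 + (w 0 * b) ^ 2))| ≤ (a ^ 2 + b ^ 2) / |b| * (w 1)⁻¹ := by
    have hsgn : |(if 1 < w 1 then (1 : ℝ) else -1)| = 1 := by split_ifs <;> simp
    have heq : |(if 1 < w 1 then (1 : ℝ) else -1) * (-b) /
        (w 1 * ((1 - w 0 * a) ^ 2 + (w 0 * b) ^ 2))| =
        |b| / ((1 - w 0 * a) ^ 2 + (w 0 * b) ^ 2) * (w 1)⁻¹ := by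
      rw [abs_div, abs_mul, hsgn, one_mul, abs_neg, abs_of_pos (mul_pos hu hd)]
      field_simp
    rw [heq]
    exact mul_le_mul_of_nonneg_right (rayCarriers_abs_div_den_le a hb0 (w 0))
      (inv_nonneg.mpr hu.le)
  -- step 2: `u⁻¹ ≤ M · s^{-1/2} · u^{-1/2}`
  have h2 : (w 1)⁻¹ ≤ max (r ^ (1 / 2 : ℝ)) (r ^ (-(1 / 2) : ℝ)) *
      (w 0 ^ (-(1 / 2) : ℝ) * w 1 ^ (-(1 / 2) : ℝ)) := by
    have hs_rpow : 1 ≤ w 0 ^ (-(1 / 2) : ℝ) :=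
      Real.one_le_rpow_of_pos_of_le_one_of_nonpos hs.1 hs.2.le (by norm_num)
    rcases hw.2 with ⟨hu1, huV⟩ | ⟨hVu, _⟩
    · -- the sheet `1 < u < s r ≤ r`
      have hur : w 1 ≤ r := (huV.trans (mul_lt_of_lt_one_left hr0 hs.2)).le
      have hu_rpow : r ^ (-(1 / 2) : ℝ) ≤ w 1 ^ (-(1 / 2) : ℝ) :=
        Real.rpow_le_rpow_of_nonpos hu hur (by norm_num)
      calc (w 1)⁻¹ ≤ 1 := inv_le_one_of_one_le₀ hu1.le
        _ = r ^ (1 / 2 : ℝ) * (1 * r ^ (-(1 / 2) : ℝ)) := by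
            rw [one_mul, ← Real.rpow_add hr0]
            norm_num
        _ ≤ _ := by
            apply mul_le_mul (le_max_left _ _) _ (by positivity) (by positivity)
            exact mul_le_mul hs_rpow hu_rpow (by positivity) (by positivity)
    · -- the sheet `s r < u < 1`
      have hV : 0 < w 0 * r := mul_pos hs.1 hr0
      calc (w 1)⁻¹ = w 1 ^ (-(1 / 2) : ℝ) * w 1 ^ (-(1 / 2) : ℝ) := by
            rw [← Real.rpow_add hu, ← Real.rpow_neg_one]
            norm_num
        _ ≤ (w 0 * r) ^ (-(1 / 2) : ℝ) * w 1 ^ (-(1 / 2) : ℝ) := by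
            apply mul_le_mul_of_nonneg_right _ (Real.rpow_nonneg hu.le _)
            exact Real.rpow_le_rpow_of_nonpos hV hVu.le (by norm_num)
        _ = r ^ (-(1 / 2) : ℝ) * (w 0 ^ (-(1 / 2) : ℝ) * w 1 ^ (-(1 / 2) : ℝ)) := by
            rw [Real.mul_rpow hs.1.le hr0.le]
            ring
        _ ≤ _ := mul_le_mul_of_nonneg_right (le_max_right _ _) (by positivity)
  calc |(if 1 < w 1 then (1 : ℝ) else -1) * (-b) / (w 1 * ((1 - w 0 * a) ^ 2 + (w 0 * b) ^ 2))|
        ≤ (a ^ 2 + b ^ 2) / |b| * (w 1)⁻¹ := h1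
    _ ≤ (a ^ 2 + b ^ 2) / |b| * (max (r ^ (1 / 2 : ℝ)) (r ^ (-(1 / 2) : ℝ)) *
          (w 0 ^ (-(1 / 2) : ℝ) * w 1 ^ (-(1 / 2) : ℝ))) :=
        mul_le_mul_of_nonneg_left h2 (by positivity)
    _ = _ := by ring

/-- **Absolute integrability of the square-rooted ray representation** (`b ≠ 0`, `r > 0`): the
integrand is dominated (`rayCarriers_ray_abs_le`) by a constant multiple of `s^{-1/2} · u^{-1/2}`
on `(0,1) × (0, max 1 r)`, a product of integrable powers (`Integrable.fintype_prod`); equivalently,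
the fibre integral `≤ M |log(s r)|` is integrable on `(0,1)` (adapted from
`KZ.integrableOn_rayDilogIntegrand`). [cite: Zagier2007Dilogarithm, Ch. I §3] -/
theorem rayCarriers_ray_integrableOn (a : ℝ) {b r : ℝ} (hr : IsAlgebraic ℚ r) (hb0 : b ≠ 0)
    (hr0 : 0 < r) :
    IntegrableOn (fun w : Fin 2 → ℝ => (if 1 < w 1 then (1 : ℝ) else -1) * (-b) /
        (w 1 * ((1 - w 0 * a) ^ 2 + (w 0 * b) ^ 2)))
      {w : Fin 2 → ℝ | (0 < w 0 ∧ w 0 < 1) ∧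
        ((1 < w 1 ∧ w 1 < w 0 * r) ∨ (w 0 * r < w 1 ∧ w 1 < 1))} := by
  have hDm : MeasurableSet {w : Fin 2 → ℝ | (0 < w 0 ∧ w 0 < 1) ∧
      ((1 < w 1 ∧ w 1 < w 0 * r) ∨ (w 0 * r < w 1 ∧ w 1 < 1))} :=
    IsSemialgebraic.measurableSet_holds (rayCarriers_ray_isSemialgebraic hr)
  have hm : Measurable (fun w : Fin 2 → ℝ => (if 1 < w 1 then (1 : ℝ) else -1) * (-b) /
      (w 1 * ((1 - w 0 * a) ^ 2 + (w 0 * b) ^ 2))) := by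
    refine Measurable.div (Measurable.mul ?_ measurable_const) ?_
    · exact Measurable.ite (measurableSet_lt measurable_const (measurable_pi_apply 1))
        measurable_const measurable_const
    · fun_prop
  -- the dominating product function
  set K : ℝ := (a ^ 2 + b ^ 2) / |b| * max (r ^ (1 / 2 : ℝ)) (r ^ (-(1 / 2) : ℝ)) with hK
  set φ : ℝ → ℝ := (Ioo (0 : ℝ) 1).indicator fun s => s ^ (-(1 / 2) : ℝ) with hφ_def
  set ψ : ℝ → ℝ := (Ioo (0 : ℝ) (max 1 r)).indicator fun u => u ^ (-(1 / 2) : ℝ) with hψ_def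
  have hφ : Integrable φ := by
    refine (integrable_indicator_iff measurableSet_Ioo).mpr ?_
    exact ((intervalIntegral.intervalIntegrable_rpow' (a := 0) (b := 1) (by norm_num)).1).mono_set
      Ioo_subset_Ioc_self
  have hψ : Integrable ψ := by
    refine (integrable_indicator_iff measurableSet_Ioo).mpr ?_
    exact ((intervalIntegral.intervalIntegrable_rpow' (a := 0) (b := max 1 r)
      (by norm_num)).1).mono_set Ioo_subset_Ioc_self
  have hg : Integrable (fun w : Fin 2 → ℝ => K * (φ (w 0) * ψ (w 1))) := by
    have h := Integrable.fintype_prod (ι := Fin 2) (f := ![φ, ψ])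
      (μ := fun _ => (volume : Measure ℝ))
      (Fin.forall_fin_two.mpr ⟨by simpa using hφ, by simpa using hψ⟩)
    have h' : Integrable (fun w : Fin 2 → ℝ => φ (w 0) * ψ (w 1)) := by
      refine h.congr (Filter.Eventually.of_forall fun w => ?_)
      simp [Fin.prod_univ_two]
    exact h'.const_mul K
  refine Integrable.mono' hg.integrableOn hm.aestronglyMeasurable ?_
  refine ae_restrict_of_forall_mem hDm fun w hw => ?_
  rw [Real.norm_eq_abs]
  have hpos := rayCarriers_ray_pos hr0 hw
  have hmem0 : w 0 ∈ Ioo (0 : ℝ) 1 := hpos.1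
  have hφw : φ (w 0) = w 0 ^ (-(1 / 2) : ℝ) := indicator_of_mem hmem0 _
  have hlt : w 1 < max 1 r := by
    rcases hw.2 with ⟨_, huV⟩ | ⟨_, hu1⟩
    · exact (huV.trans (mul_lt_of_lt_one_left hr0 hpos.1.2)).trans_le (le_max_right _ _)
    · exact hu1.trans_le (le_max_left _ _)
  have hmem1 : w 1 ∈ Ioo (0 : ℝ) (max 1 r) := ⟨hpos.2, hlt⟩
  have hψw : ψ (w 1) = w 1 ^ (-(1 / 2) : ℝ) := indicator_of_mem hmem1 _
  rw [hφw, hψw]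
  exact rayCarriers_ray_abs_le a hb0 hr0 hw

/-- Conjunct (3) of `stub_rayCarriersExist` (registered sub-goal `rayCarriersAux_ray`): the
SQUARE-ROOTED RAY REPRESENTATION
`Ray₁(a, b, r) = [{0 < s < 1, u strictly between 1 and s r}, sgn(u − 1)(−b)/(u q(s))]`,
`q(s) = (1 − s a)² + (s b)²`, IS an integral representation for real algebraic `a`, `b > 0`,
`r > 0`. [cite: KontsevichZagier2001, §1.1] -/
theorem rayCarriersAux_ray :
    ∀ (a b r : ℝ), IsAlgebraic ℚ a → IsAlgebraic ℚ b → IsAlgebraic ℚ r → 0 < b → 0 < r →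
      ∃ R₁ : KZ.IntegralRep 2,
        R₁.domain = {w | (0 < w 0 ∧ w 0 < 1) ∧
          ((1 < w 1 ∧ w 1 < w 0 * r) ∨ (w 0 * r < w 1 ∧ w 1 < 1))} ∧
        R₁.integrand = fun w =>
          (if 1 < w 1 then (1 : ℝ) else -1) * (-b) /
            (w 1 * ((1 - w 0 * a) ^ 2 + (w 0 * b) ^ 2)) :=
  fun a _ _ ha hb hr hb0 hr0 =>
    ⟨⟨_, _, rayCarriers_ray_isSemialgebraic hr,
      rayCarriers_ray_isSemialgebraicFunOn ha hb hr hb0.ne' hr0,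
      rayCarriers_ray_integrableOn a hr hb0.ne' hr0⟩, rfl, rfl⟩

end Summit.KontsevichZagierPeriods.HyperbolicBloch.OffTetraSectorKernel

end
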